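import Summits.CriticalPhenomena.PercolationContinuityZ3.Theorems.PercNearOneGluingNoHeavyQuantFarSunWitnessCert
import HarnessLib

/-!
# FAR beyond trees: FRACTIONAL universal-witness certificates for `SunFAR K j` (the averaged witness weight)

builds on p205010 (kernel theorem, internal audit signed; external expert review pending)

Support file (`--supports stmt-CriticalPhenomena-4575`), seat `prim-cert-1` (gen 35); memo `prim-cert-1/FROM-prim-cert-1-g35-FRAME-COVERING.md`.

`HairyCycle.hairCert_of_witness` (p374886) turns ONE selection `z Q ∈ wit j Q` of a witness per open-hair pattern into a hair-only certificate as
soon as its witness weight `G = E[1/h_z ; wit ≠ ∅] ≥ 1`.  Here the selection may be FRACTIONAL: a kernel `w Q k ≥ 0` supported on the witness set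
`wit j Q` with `Σ_{k ∈ wit j Q} w Q k ≤ 1` (`HairyCycle.IsWitKernel`).  The masses `p_k = Σ_Q hairW Q · w Q k` (`HairyCycle.witMassW`) still satisfy
`Σ_{k ∈ C} p_k ≤ hairV K h j C` on every coverage set (a coverage set meeting the witness set carries `≥ j+1` open hairs,
`HairyCycle.card_inter_cov_of_mem_wit`), so `G_w := Σ_k p_k / h_k ≥ 1` (`HairyCycle.witGW`) again gives the certificate `λ_k = p_k/(h_k G_w)`, `μ = 0`
(**`HairyCycle.hairCert_of_witKernel`**).  The point: the UNIFORM kernel `w Q k = 1/#(wit j Q)` (`HairyCycle.witAvgKernel`) has weight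
`G_avg = E[(1/#wit) Σ_{d ∈ wit} 1/h_d ; wit ≠ ∅]`, which is MULTILINEAR in `h` and computable in polynomial time from prefix/suffix success counts
(`G_avg = Σ_k E[𝟙{A_k ≥ j, B_k ≥ j}/(A_k + B_k + 1 − 2j)]`, `A_k`/`B_k` = open hairs strictly below/above `k`; memo §3), whereas the optimal (argmin)
selection carries a `max`.  Numerically (memo §4) `G_avg ≥ 1` on the whole region where the weakest-hair bet fails, for `j = 2` and every `K ≥ 10`
tested — the form in which the all-`K` programme for layer 2 now states its one remaining inequality.  **`HairyCycle.hairCert_of_witAvg`** /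
**`HairyCycle.sunFAR_of_hairCert_lowWitAvg`**: the certificate from `G_avg ≥ 1`, and the reduction of `SunFAR K j` to hair-only certificates in the
regime `G_avg < 1`.  No sorries; standard axioms.  Elementary [this work].
[cite: KozmaNitzan2024, Conjecture 3 (p. 15)] (context: the lower-tail family FAR serves).
-/

noncomputable section

namespace Summit.CriticalPhenomena.PercolationContinuityZ3.Theorems.HairyCycle

open Finset
open scoped Classical

variable {K : ℕ}

/-! ## Witness kernels and their masses -/

/-- **Witness kernel** at layer `j` on the patterns of `range K`: nonnegative weights `w Q k`, vanishing unless `k` is a witness of `Q`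
(`k ∈ wit j Q`), of total mass at most one on every pattern `Q ⊆ range K`. [this work] -/
def IsWitKernel (K j : ℕ) (w : Finset ℕ → ℕ → ℝ) : Prop :=
  (∀ Q k, 0 ≤ w Q k) ∧ (∀ Q k, k ∉ wit j Q → w Q k = 0) ∧ ∀ Q, Q ⊆ range K → ∑ k ∈ wit j Q, w Q k ≤ 1

/-- **Kernel witness mass at position `k`**: `p_k = Σ_{Q ⊆ range K} hairW K h Q · w Q k`. [this work] -/
def witMassW (K : ℕ) (h : ℕ → ℝ) (w : Finset ℕ → ℕ → ℝ) (k : ℕ) : ℝ :=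
  ∑ Q ∈ (range K).powerset, hairW K h Q * w Q k

/-- **Kernel witness weight** `G_w = Σ_{k<K} p_k / h_k`. [this work] -/
def witGW (K : ℕ) (h : ℕ → ℝ) (w : Finset ℕ → ℕ → ℝ) : ℝ :=
  ∑ k ∈ range K, witMassW K h w k / h k

/-- The kernel witness mass is nonnegative (`h ∈ [0,1]`). [this work] -/
theorem witMassW_nonneg {h : ℕ → ℝ} (hh : ∀ k, k < K → 0 ≤ h k ∧ h k ≤ 1) {j : ℕ} {w : Finset ℕ → ℕ → ℝ}
    (hw : IsWitKernel K j w) (k : ℕ) : 0 ≤ witMassW K h w k :=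
  Finset.sum_nonneg fun Q _ => mul_nonneg (hairW_nonneg hh Q) (hw.1 Q k)

/-- The kernel witness mass vanishes at a dead position (`h k = 0`). [this work] -/
theorem witMassW_eq_zero_of_h_eq_zero {h : ℕ → ℝ} {j : ℕ} {w : Finset ℕ → ℕ → ℝ} (hw : IsWitKernel K j w)
    {k : ℕ} (h0 : h k = 0) : witMassW K h w k = 0 := by
  refine Finset.sum_eq_zero fun Q hQ => ?_
  rw [Finset.mem_powerset] at hQ
  by_cases hk : k ∈ wit j Q
  · have hkQ : k ∈ Q := mem_of_mem_wit hk
    rw [hairW_eq_zero_of_mem (Finset.mem_range.1 (hQ hkQ)) hkQ h0, zero_mul]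
  · rw [hw.2.1 Q k hk, mul_zero]

/-- The kernel witness mass vanishes at positions `k ≥ K`. [this work] -/
theorem witMassW_eq_zero_of_le {h : ℕ → ℝ} {j : ℕ} {w : Finset ℕ → ℕ → ℝ} (hw : IsWitKernel K j w)
    {k : ℕ} (hk : K ≤ k) : witMassW K h w k = 0 := by
  refine Finset.sum_eq_zero fun Q hQ => ?_
  rw [Finset.mem_powerset] at hQ
  by_cases hkw : k ∈ wit j Q
  · exact absurd (Finset.mem_range.1 (hQ (mem_of_mem_wit hkw))) (not_lt.2 hk)
  · rw [hw.2.1 Q k hkw, mul_zero]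

/-- `(p_k / h_k) · h_k = p_k` (also when `h k = 0`). [this work] -/
theorem witMassW_div_mul {h : ℕ → ℝ} {j : ℕ} {w : Finset ℕ → ℕ → ℝ} (hw : IsWitKernel K j w) (k : ℕ) :
    witMassW K h w k / h k * h k = witMassW K h w k := by
  by_cases h0 : h k = 0
  · rw [witMassW_eq_zero_of_h_eq_zero hw h0, zero_div, zero_mul]
  · exact div_mul_cancel₀ _ h0

/-- For one pattern, the kernel mass on a coverage set is at most `𝟙[j+1 ≤ #(Q ∩ C)]`. [this work] -/
theorem sum_kernel_cov_le {j : ℕ} {w : Finset ℕ → ℕ → ℝ} (hw : IsWitKernel K j w) {Q : Finset ℕ} (hQ : Q ⊆ range K)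
    (l l' : ℕ) :
    ∑ k ∈ cov K l l', w Q k ≤ if j + 1 ≤ (Q ∩ cov K l l').card then 1 else 0 := by
  by_cases hc : ∃ k ∈ cov K l l', k ∈ wit j Q
  · obtain ⟨k, hkC, hkw⟩ := hc
    rw [if_pos (card_inter_cov_of_mem_wit hQ hkw hkC)]
    have h1 : ∑ k ∈ cov K l l' ∩ wit j Q, w Q k = ∑ k ∈ cov K l l', w Q k :=
      Finset.sum_subset Finset.inter_subset_left fun x hx hx' =>
        hw.2.1 Q x (fun hxw => hx' (Finset.mem_inter.2 ⟨hx, hxw⟩))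
    rw [← h1]
    exact (Finset.sum_le_sum_of_subset_of_nonneg Finset.inter_subset_right fun k _ _ => hw.1 Q k).trans (hw.2.2 Q hQ)
  · push Not at hc
    have : ∑ k ∈ cov K l l', w Q k = 0 := Finset.sum_eq_zero fun k hk => hw.2.1 Q k (hc k hk)
    rw [this]
    split_ifs <;> norm_num

/-- **Kernel witness mass on a coverage set ≤ its hair-only value**: `Σ_{k ∈ C} p_k ≤ hairV K h j C`, `C = cov K l l'`. [this work] -/
theorem sum_witMassW_cov_le_hairV {h : ℕ → ℝ} (hh : ∀ k, k < K → 0 ≤ h k ∧ h k ≤ 1) {j : ℕ} {w : Finset ℕ → ℕ → ℝ}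
    (hw : IsWitKernel K j w) (l l' : ℕ) :
    ∑ k ∈ cov K l l', witMassW K h w k ≤ hairV K h j (cov K l l') := by
  unfold witMassW hairV
  rw [Finset.sum_comm]
  refine Finset.sum_le_sum fun Q hQ => ?_
  rw [Finset.mem_powerset] at hQ
  rw [← Finset.mul_sum]
  exact mul_le_mul_of_nonneg_left (sum_kernel_cov_le hw hQ l l') (hairW_nonneg hh Q)

/-! ## The certificate from a kernel -/

/-- **FRACTIONAL UNIVERSAL-WITNESS CERTIFICATE.**  For `h ∈ [0,1]` and a witness kernel `w` with weight `G_w = Σ_k p_k/h_k ≥ 1`, the weights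
`λ_k = p_k/(h_k G_w)`, `μ = 0` form a hair-only certificate (the hypothesis shape of `HairyCycle.sunFAR_of_hairCert`). [this work] -/
theorem hairCert_of_witKernel {h : ℕ → ℝ} (hh : ∀ k, k < K → 0 ≤ h k ∧ h k ≤ 1) {j : ℕ} {w : Finset ℕ → ℕ → ℝ}
    (hw : IsWitKernel K j w) (hG : 1 ≤ witGW K h w) :
    ∃ lam : ℕ → ℝ, ∃ μ : ℝ, (∀ k, 0 ≤ lam k) ∧ ∑ k ∈ range K, lam k = 1 ∧ 0 ≤ μ ∧
      ∀ p ∈ arcIx K, ∑ k ∈ cov K p.1 p.2, lam k * h k + μ * (∑ k ∈ cov K p.1 p.2, h k - 2 * j) ≤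
        hairV K h j (cov K p.1 p.2) := by
  have hGpos : 0 < witGW K h w := lt_of_lt_of_le one_pos hG
  refine ⟨fun k => witMassW K h w k / h k / witGW K h w, 0, fun k => ?_, ?_, le_rfl, fun p _ => ?_⟩
  · refine div_nonneg ?_ hGpos.le
    by_cases h0 : h k = 0
    · rw [h0, div_zero]
    · by_cases hk : k < K
      · exact div_nonneg (witMassW_nonneg hh hw k) (hh k hk).1
      · rw [witMassW_eq_zero_of_le hw (not_lt.1 hk), zero_div]
  · rw [← Finset.sum_div, div_eq_one_iff_eq hGpos.ne']
    rfl
  · rw [zero_mul, add_zero]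
    have h1 : ∑ k ∈ cov K p.1 p.2, witMassW K h w k / h k / witGW K h w * h k =
        (∑ k ∈ cov K p.1 p.2, witMassW K h w k) / witGW K h w := by
      rw [Finset.sum_div]
      refine Finset.sum_congr rfl fun k _ => ?_
      rw [div_mul_eq_mul_div, witMassW_div_mul hw]
    rw [h1]
    have hV : 0 ≤ hairV K h j (cov K p.1 p.2) :=
      Finset.sum_nonneg fun Q _ => mul_nonneg (hairW_nonneg hh Q) (by split_ifs <;> norm_num)
    calc (∑ k ∈ cov K p.1 p.2, witMassW K h w k) / witGW K h w
        ≤ hairV K h j (cov K p.1 p.2) / witGW K h w :=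
          div_le_div_of_nonneg_right (sum_witMassW_cov_le_hairV hh hw p.1 p.2) hGpos.le
      _ ≤ hairV K h j (cov K p.1 p.2) := div_le_self hV hG

/-! ## The averaged (uniform) kernel -/

/-- **The uniform witness kernel**: `w Q k = 1/#(wit j Q)` for `k ∈ wit j Q`, else `0`. [this work] -/
def witAvgKernel (j : ℕ) (Q : Finset ℕ) (k : ℕ) : ℝ :=
  if k ∈ wit j Q then 1 / ((wit j Q).card : ℝ) else 0

/-- **Averaged witness weight** `G_avg = Σ_k p_k/h_k` for the uniform kernel
(`= E[(1/#wit) Σ_{d ∈ wit} 1/h_d ; wit ≠ ∅]`). [this work] -/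
def witGavg (K : ℕ) (h : ℕ → ℝ) (j : ℕ) : ℝ :=
  witGW K h (witAvgKernel j)

/-- The uniform kernel is a witness kernel (for every `K`). [this work] -/
theorem isWitKernel_witAvgKernel (K j : ℕ) : IsWitKernel K j (witAvgKernel j) := by
  refine ⟨fun Q k => ?_, fun Q k hk => ?_, fun Q _ => ?_⟩
  · unfold witAvgKernel
    split_ifs
    · exact div_nonneg zero_le_one (Nat.cast_nonneg _)
    · exact le_rfl
  · unfold witAvgKernel
    rw [if_neg hk]
  · by_cases hne : (wit j Q).Nonempty
    · have hcard : (0 : ℝ) < (wit j Q).card := by exact_mod_cast Finset.card_pos.2 hne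
      have hsum : ∑ k ∈ wit j Q, witAvgKernel j Q k = 1 := by
        have : ∑ k ∈ wit j Q, witAvgKernel j Q k = ∑ k ∈ wit j Q, 1 / ((wit j Q).card : ℝ) :=
          Finset.sum_congr rfl fun k hk => by unfold witAvgKernel; rw [if_pos hk]
        rw [this, Finset.sum_const, nsmul_eq_mul, mul_one_div, div_self hcard.ne']
      exact hsum.le
    · rw [Finset.not_nonempty_iff_eq_empty.1 hne, Finset.sum_empty]
      exact zero_le_one

/-- **The certificate from the averaged witness weight**: `G_avg ≥ 1` gives a hair-only certificate (`μ = 0`). [this work] -/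
theorem hairCert_of_witAvg {h : ℕ → ℝ} (hh : ∀ k, k < K → 0 ≤ h k ∧ h k ≤ 1) {j : ℕ} (hG : 1 ≤ witGavg K h j) :
    ∃ lam : ℕ → ℝ, ∃ μ : ℝ, (∀ k, 0 ≤ lam k) ∧ ∑ k ∈ range K, lam k = 1 ∧ 0 ≤ μ ∧
      ∀ p ∈ arcIx K, ∑ k ∈ cov K p.1 p.2, lam k * h k + μ * (∑ k ∈ cov K p.1 p.2, h k - 2 * j) ≤
        hairV K h j (cov K p.1 p.2) :=
  hairCert_of_witKernel hh (isWitKernel_witAvgKernel K j) hG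

/-- **Reduction of `SunFAR K j` to the regime `G_avg < 1`** (`K ≥ 2`): hair-only certificates need only be supplied for `g, h ∈ [0,1]` with
`2j < EN` and averaged witness weight `witGavg K h j < 1`. [this work] -/
theorem sunFAR_of_hairCert_lowWitAvg (hK : 2 ≤ K) {j : ℕ}
    (hc : ∀ g h : ℕ → ℝ, (∀ m, m ≤ K → 0 ≤ g m ∧ g m ≤ 1) → (∀ k, k < K → 0 ≤ h k ∧ h k ≤ 1) →
      (2 * j : ℝ) < ∑ k ∈ range K, sunMarg K g h k → witGavg K h j < 1 →
      ∃ lam : ℕ → ℝ, ∃ μ : ℝ, (∀ k, 0 ≤ lam k) ∧ ∑ k ∈ range K, lam k = 1 ∧ 0 ≤ μ ∧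
        ∀ p ∈ arcIx K, ∑ k ∈ cov K p.1 p.2, lam k * h k + μ * (∑ k ∈ cov K p.1 p.2, h k - 2 * j) ≤
          hairV K h j (cov K p.1 p.2)) :
    SunFAR K j := by
  refine sunFAR_of_hairCert hK fun g h hg hh hEN => ?_
  by_cases hG : 1 ≤ witGavg K h j
  · exact hairCert_of_witAvg hh hG
  · exact hc g h hg hh hEN (lt_of_not_ge hG)

end Summit.CriticalPhenomena.PercolationContinuityZ3.Theorems.HairyCycle

end
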